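import Mathlib
import HarnessLib
import Summits.CriticalPhenomena.SAWScalingLimit.Theses.SAWDefectDecoherence
import Summits.CriticalPhenomena.SAWScalingLimit.Theorems.DefectDecoherence.Negative.WallExitTwoPoint
import Summits.CriticalPhenomena.SAWScalingLimit.Theorems.MassRatio.Negative.Tools
import Literature.Probability.LatticeModels.TriangularLatticeProofs

/-!
# `DecoherenceSynthesis` (stmt-CriticalPhenomena-8558, route `SAWDefectDecoherence`)

The layer-1 glue `BoundaryWindingRigidity → DefectDecoherence → MassRatio → ConjugateClassNegligible`,
pure bookkeeping (Duminil-Copin–Smirnov 2012 §4, the "other half" of discrete Cauchy–Riemann read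
weakly against a `C¹` bulk test function `ψ`, `K := tsupport ψ ⊆ Ω`, `K' = K_ε`, `K'' = K_{2ε} ⊆ Ω`):
* the black → white mid-edge `finsum` is a finite sum; for small `δ` it is regrouped by the black
  endpoint `b` (a non-zero summand has `δ·mid ∈ K`, so `δ c_b ∈ K'`, so `b ∈ Λ_δ` by exhaustion, and `b`
  is `R`-deep, `R = ε/δ`);
* per black vertex (`star_sum_norm_le`): `Σ_{w∼b} ψ(δ·mid) conj(c_w - c_b) F = ψ(δc_b)·2Σ_w conj(mid -
  c_b) F + Σ_w [ψ(δ·mid) - ψ(δc_b)] conj(c_w - c_b) F`, the defect bounded by `DefectDecoherence`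
  (`|C_D| R^{-θ} Σ_w Z`), the Taylor term by `(Lδ/2) Σ_w Z` (`L` = Lipschitz constant of `ψ`);
* the black stars inject into the mid-edges over `K''`, `MassRatio` bounds `δ² ΣΣ Z` by
  `|C_M| δ^{-3/4} Z_δ(b_δ)`, and winding rigidity gives `‖F_δ(b_δ)‖ = Z_δ(b_δ) > 0`;
* total `≤ 2M₀|C_D||C_M| ε^{-θ} δ^{θ-3/4} + (L/2)|C_M| δ^{1/4} → 0` since `θ > 3/4`.
-/

namespace Summit.CriticalPhenomena.SAWScalingLimit.Theorems

open scoped BigOperators Topology ComplexConjugate Classical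
open Filter Set Metric Literature.Probability.LatticeModels Literature.Probability.RandomPlanarGeometry
  Literature.Probability.RandomPlanarGeometry.SAW Summit.CriticalPhenomena.SAWScalingLimit.Theses.SAWDefectDecoherence
open Summit.CriticalPhenomena.SAWScalingLimit.Cruxes.DefectDecoherence.TipMartingaleDepthInduction.WallExitTwoPoint
  (dist_hexCenter_le_one_of_adj)
open Summit.CriticalPhenomena.SAWScalingLimit.Theorems.MassRatio.Negative (hexDomainMidEdges_finite)

noncomputable section

namespace DecoherenceSynthesis

/-- The honeycomb lattice is bipartite: a neighbour of a black vertex (`b.2 = 0`) is white. -/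
theorem snd_eq_one_of_adj {b w : HexVertex} (h : hexGraph.Adj b w) (hb : b.2 = 0) : w.2 = 1 := by
  have hne : b.2 ≠ w.2 := fun heq =>
    Literature.Probability.LatticeModels.not_hexGraph_adj_of_snd_eq_holds b w heq h
  omega

/-- `mid{v,t} - c_v = (c_t - c_v) / 2`. -/
theorem hexMidpoint_sub_hexCenter (v t : HexVertex) :
    hexMidpoint s(v, t) - hexCenter v = (hexCenter t - hexCenter v) / 2 := by
  rw [hexMidpoint_mk]; ring

/-- A mid-edge is within `1/2` of its endpoints (neighbours are at distance `1/√3 ≤ 1`). -/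
theorem norm_hexMidpoint_sub_hexCenter_le {v t : HexVertex} (h : hexGraph.Adj v t) :
    ‖hexMidpoint s(v, t) - hexCenter v‖ ≤ 1 / 2 := by
  rw [hexMidpoint_sub_hexCenter, norm_div, Complex.norm_two, ← dist_eq_norm]
  linarith [dist_hexCenter_le_one_of_adj h]

/-- Scaling distances by the mesh. -/
theorem dist_smul_smul {δ : ℝ} (hδ : 0 ≤ δ) (x y : ℂ) :
    dist ((δ : ℂ) * x) ((δ : ℂ) * y) = δ * dist x y := by
  rw [dist_eq_norm, dist_eq_norm, ← mul_sub, norm_mul, Complex.norm_of_nonneg hδ]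

/-- `‖F_{x,0}(z)‖ = Σ_γ x^{ℓ(γ)}`: the two-point mass is a nonnegative real. -/
theorem norm_obs_zero_spin (Λ : Finset HexVertex) (a z : Sym2 HexVertex) {x : ℝ} (hx : 0 ≤ x) :
    ‖hexParafermionicObservable Λ a x 0 z‖ = ∑ γ : HexMidEdgeSAW Λ a z, x ^ γ.length := by
  rw [hexParafermionicObservable_zero_spin, Complex.norm_real,
    Real.norm_of_nonneg (Finset.sum_nonneg fun γ _ => pow_nonneg hx _)]

/-- A walk `a → b` makes the two-point mass at `b` positive. -/
theorem norm_obs_zero_pos {Λ : Finset HexVertex} {a b : Sym2 HexVertex}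
    (hne : Nonempty (HexMidEdgeSAW Λ a b)) {x : ℝ} (hx : 0 < x) :
    0 < ‖hexParafermionicObservable Λ a x 0 b‖ := by
  rw [norm_obs_zero_spin Λ a b hx.le]
  obtain ⟨γ₀⟩ := hne
  exact lt_of_lt_of_le (pow_pos hx _)
    (Finset.single_le_sum (fun γ _ => pow_nonneg hx.le _) (Finset.mem_univ γ₀))

/-- **Boundary normalisation.** Under `BoundaryWindingRigidity` all walks between two boundary
mid-edges of a simply connected domain carry one phase, so `‖F_{x,σ}(b)‖ = ‖F_{x,0}(b)‖ = Z(b)`. -/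
theorem norm_obs_eq_of_rigidity (hW : BoundaryWindingRigidity) {Λ : Finset HexVertex}
    (hΛ : hexDomainSimplyConnected Λ) {a b : Sym2 HexVertex} (ha : a ∈ hexDomainBoundary Λ)
    (hb : b ∈ hexDomainBoundary Λ) (x σ : ℝ) :
    ‖hexParafermionicObservable Λ a x σ b‖ = ‖hexParafermionicObservable Λ a x 0 b‖ := by
  rcases isEmpty_or_nonempty (HexMidEdgeSAW Λ a b) with hE | ⟨⟨γ₀⟩⟩
  · simp [hexParafermionicObservable_def]
  · have key : hexParafermionicObservable Λ a x σ b =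
        Complex.exp (-Complex.I * σ * (γ₀.winding : ℝ)) * hexParafermionicObservable Λ a x 0 b := by
      rw [hexParafermionicObservable_def, hexParafermionicObservable_def, Finset.mul_sum]
      refine Finset.sum_congr rfl fun γ _ => ?_
      rw [HexMidEdgeSAW.weight, HexMidEdgeSAW.weight_zero_spin, hW Λ hΛ a ha b hb γ γ₀]
    rw [key, norm_mul, Complex.norm_exp]
    simp

/-- **Per black vertex (defect + Taylor).** If the conjugated star sum (vertex-star defect) at `v` is
`≤ D Σ_t Z({v,t})` and `ψ` is bounded by `M₀` and `L`-Lipschitz, the `ψ`-weighted conjugate-class star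
sum at `v` is `≤ (2 M₀ D + L δ / 2) Σ_t Z({v,t})` (uses `|F_{5/8}| ≤ F_0 = Z`, `|c_t - c_v| ≤ 1`). -/
theorem star_sum_norm_le {Λ : Finset HexVertex} {a : Sym2 HexVertex} {ψ : ℂ → ℂ} {M₀ L : ℝ}
    (hM₀ : ∀ z, ‖ψ z‖ ≤ M₀) (hL : ∀ z z', ‖ψ z - ψ z'‖ ≤ L * ‖z - z'‖) (hL0 : 0 ≤ L)
    {δ : ℝ} (hδ : 0 ≤ δ) (v : HexVertex) {D : ℝ}
    (hdef : ‖∑ t ∈ Λ.filter (fun t => hexGraph.Adj v t),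
        conj (hexMidpoint s(v, t) - hexCenter v) *
          hexParafermionicObservable Λ a hexCriticalFugacity (5 / 8) s(v, t)‖
        ≤ D * ∑ t ∈ Λ.filter (fun t => hexGraph.Adj v t),
          ‖hexParafermionicObservable Λ a hexCriticalFugacity 0 s(v, t)‖) :
    ‖∑ t ∈ Λ.filter (fun t => hexGraph.Adj v t), ψ ((δ : ℂ) * hexMidpoint s(v, t)) *
        conj (hexCenter t - hexCenter v) *
          hexParafermionicObservable Λ a hexCriticalFugacity (5 / 8) s(v, t)‖
      ≤ (2 * M₀ * D + L * δ / 2) *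
        ∑ t ∈ Λ.filter (fun t => hexGraph.Adj v t),
          ‖hexParafermionicObservable Λ a hexCriticalFugacity 0 s(v, t)‖ := by
  set N := Λ.filter (fun t => hexGraph.Adj v t) with hN
  set F : HexVertex → ℂ := fun t => hexParafermionicObservable Λ a hexCriticalFugacity (5 / 8) s(v, t)
    with hF
  set Z : HexVertex → ℝ := fun t => ‖hexParafermionicObservable Λ a hexCriticalFugacity 0 s(v, t)‖
    with hZ
  have hxc : 0 ≤ hexCriticalFugacity := hexCriticalFugacity_pos_lt_one.1.le
  have hadj : ∀ t ∈ N, hexGraph.Adj v t := fun t ht => (Finset.mem_filter.1 ht).2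
  have hFZ : ∀ t, ‖F t‖ ≤ Z t := fun t => by
    show ‖F t‖ ≤ ‖hexParafermionicObservable Λ a hexCriticalFugacity 0 s(v, t)‖
    rw [norm_obs_zero_spin Λ a _ hxc]
    exact norm_hexParafermionicObservable_le Λ a hxc (5 / 8) s(v, t)
  have hM₀0 : 0 ≤ M₀ := (norm_nonneg _).trans (hM₀ 0)
  -- the split
  have hconj : ∀ t, conj (hexCenter t - hexCenter v) =
      2 * conj (hexMidpoint s(v, t) - hexCenter v) := by
    intro t
    rw [hexMidpoint_sub_hexCenter, map_div₀]
    simp only [map_ofNat]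
    ring
  have hsplit : ∑ t ∈ N, ψ ((δ : ℂ) * hexMidpoint s(v, t)) * conj (hexCenter t - hexCenter v) * F t
      = ψ ((δ : ℂ) * hexCenter v) *
          (2 * ∑ t ∈ N, conj (hexMidpoint s(v, t) - hexCenter v) * F t)
        + ∑ t ∈ N, (ψ ((δ : ℂ) * hexMidpoint s(v, t)) - ψ ((δ : ℂ) * hexCenter v)) *
            conj (hexCenter t - hexCenter v) * F t := by
    rw [Finset.mul_sum, Finset.mul_sum, ← Finset.sum_add_distrib]
    refine Finset.sum_congr rfl fun t _ => ?_
    rw [hconj t]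
    ring
  rw [hsplit]
  -- the defect term
  have hA : ‖ψ ((δ : ℂ) * hexCenter v) *
      (2 * ∑ t ∈ N, conj (hexMidpoint s(v, t) - hexCenter v) * F t)‖
      ≤ 2 * M₀ * D * ∑ t ∈ N, Z t := by
    rw [norm_mul, norm_mul, Complex.norm_two]
    calc ‖ψ ((δ : ℂ) * hexCenter v)‖ * (2 * ‖∑ t ∈ N, conj (hexMidpoint s(v, t) - hexCenter v) * F t‖)
        ≤ M₀ * (2 * (D * ∑ t ∈ N, Z t)) :=
          mul_le_mul (hM₀ _) (mul_le_mul_of_nonneg_left hdef (by norm_num)) (by positivity) hM₀0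
      _ = 2 * M₀ * D * ∑ t ∈ N, Z t := by ring
  -- the Taylor term
  have hB : ‖∑ t ∈ N, (ψ ((δ : ℂ) * hexMidpoint s(v, t)) - ψ ((δ : ℂ) * hexCenter v)) *
      conj (hexCenter t - hexCenter v) * F t‖ ≤ L * δ / 2 * ∑ t ∈ N, Z t := by
    rw [Finset.mul_sum]
    refine (norm_sum_le _ _).trans (Finset.sum_le_sum fun t ht => ?_)
    have h1 : ‖ψ ((δ : ℂ) * hexMidpoint s(v, t)) - ψ ((δ : ℂ) * hexCenter v)‖ ≤ L * (δ / 2) := by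
      refine (hL _ _).trans (mul_le_mul_of_nonneg_left ?_ hL0)
      rw [← mul_sub, norm_mul, Complex.norm_of_nonneg hδ]
      exact mul_le_mul_of_nonneg_left
        ((norm_hexMidpoint_sub_hexCenter_le (hadj t ht)).trans (le_of_eq (by norm_num))) hδ
    have h2 : ‖conj (hexCenter t - hexCenter v)‖ ≤ 1 := by
      rw [Complex.norm_conj, ← dist_eq_norm]
      exact dist_hexCenter_le_one_of_adj (hadj t ht)
    rw [norm_mul, norm_mul]
    calc ‖ψ ((δ : ℂ) * hexMidpoint s(v, t)) - ψ ((δ : ℂ) * hexCenter v)‖ *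
          ‖conj (hexCenter t - hexCenter v)‖ * ‖F t‖
        ≤ L * (δ / 2) * 1 * Z t :=
          mul_le_mul (mul_le_mul h1 h2 (norm_nonneg _) (by positivity)) (hFZ t) (norm_nonneg _)
            (by positivity)
      _ = L * δ / 2 * Z t := by ring
  calc _ ≤ _ := norm_add_le _ _
    _ ≤ 2 * M₀ * D * ∑ t ∈ N, Z t + L * δ / 2 * ∑ t ∈ N, Z t := add_le_add hA hB
    _ = (2 * M₀ * D + L * δ / 2) * ∑ t ∈ N, Z t := by ring

end DecoherenceSynthesis

open DecoherenceSynthesis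

/-- **`DecoherenceSynthesis`** (stmt-CriticalPhenomena-8558), the layer-1 glue of route
`SAWDefectDecoherence`: group the black → white edge sum by black vertex, bound the vertex-star
defects by `DefectDecoherence` at depth `ε/δ`, the Taylor term by the Lipschitz constant of `ψ`, the
masses by `MassRatio` on the `2ε`-thickening of `tsupport ψ`, normalise by `‖F_δ(b_δ)‖ = Z_δ(b_δ)`
(winding rigidity): total `O(δ^{θ-3/4} + δ^{1/4}) → 0`. -/
theorem DecoherenceSynthesis_proof :
    Summit.CriticalPhenomena.SAWScalingLimit.Theses.SAWDefectDecoherence.DecoherenceSynthesis := by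
  intro hW hDD hMR D ρ Λ m a b ψ F hρ hflat hadm hexh ha hb hψ hψc hψΩ
  -- constants of the two exponent cruxes and of the test function
  obtain ⟨C_D, θ, hθ, hDD⟩ := hDD
  obtain ⟨M₀, hM₀⟩ := hψ.continuous.bounded_above_of_compact_support hψc
  obtain ⟨Lc, hLc⟩ := hψ.lipschitzWith_of_hasCompactSupport hψc one_ne_zero
  set L : ℝ := (Lc : ℝ) with hLdef
  have hL0 : 0 ≤ L := Lc.2
  have hL : ∀ z z', ‖ψ z - ψ z'‖ ≤ L * ‖z - z'‖ := fun z z' => hLc.norm_sub_le z z'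
  have hM₀0 : 0 ≤ M₀ := (norm_nonneg _).trans (hM₀ 0)
  -- the compact support and its thickenings inside `Ω`
  set K : Set ℂ := tsupport ψ with hKdef
  have hKc : IsCompact K := hψc
  obtain ⟨ε₀, hε₀, hε₀Ω⟩ := hKc.exists_cthickening_subset_open D.isOpen hψΩ
  set ε : ℝ := ε₀ / 2 with hεdef
  have hε : 0 < ε := by positivity
  set K' : Set ℂ := cthickening ε K with hK'def
  set K'' : Set ℂ := cthickening ε₀ K with hK''def
  have hK''c : IsCompact K'' := hKc.cthickening
  have hK'K'' : cthickening ε K' ⊆ K'' := by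
    have h := cthickening_cthickening_subset hε.le hε.le K
    rwa [show ε + ε = ε₀ by rw [hεdef]; ring] at h
  have hK'sub : K' ⊆ K'' := (self_subset_cthickening K').trans hK'K''
  -- MassRatio on `K''`, exhaustion of `K''`, small `δ`
  obtain ⟨C_M, hCM⟩ := hMR D ρ Λ m a b hρ hflat hadm hexh ha hb K'' hK''c hε₀Ω
  have hexh'' := hexh K'' hK''c hε₀Ω
  have hsmall : ∀ᶠ δ : ℝ in 𝓝[>] 0, 0 < δ ∧ δ < ε := by
    filter_upwards [Ioo_mem_nhdsGT hε] with δ hδ using ⟨hδ.1, hδ.2⟩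
  have hxc : 0 < hexCriticalFugacity := hexCriticalFugacity_pos_lt_one.1
  -- the majorant
  set g : ℝ → ℝ := fun δ => 2 * M₀ * |C_D| * |C_M| * ε ^ (-θ) * δ ^ (θ - 3 / 4) +
    L / 2 * |C_M| * δ ^ (1 / 4 : ℝ) with hgdef
  have hg : Tendsto g (𝓝[>] 0) (𝓝 0) := by
    apply tendsto_nhdsWithin_of_tendsto_nhds
    have h1 : Tendsto (fun δ : ℝ => δ ^ (θ - 3 / 4)) (𝓝 0) (𝓝 0) := by
      have h := (Real.continuousAt_rpow_const 0 (θ - 3 / 4) (Or.inr (by linarith))).tendsto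
      rwa [Real.zero_rpow (by linarith)] at h
    have h2 : Tendsto (fun δ : ℝ => δ ^ (1 / 4 : ℝ)) (𝓝 0) (𝓝 0) := by
      have h := (Real.continuousAt_rpow_const 0 (1 / 4 : ℝ) (Or.inr (by norm_num))).tendsto
      rwa [Real.zero_rpow (by norm_num)] at h
    have h := (h1.const_mul (2 * M₀ * |C_D| * |C_M| * ε ^ (-θ))).add (h2.const_mul (L / 2 * |C_M|))
    simpa [hgdef] using h
  refine squeeze_zero_norm' ?_ hg
  filter_upwards [hadm, hCM, hexh'', hsmall] with δ hadmδ hCMδ hexhδ hδ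
  show ‖((δ : ℂ) ^ 2 * (∑ᶠ p ∈ {p : HexVertex × HexVertex |
      s(p.1, p.2) ∈ hexDomainMidEdges (Λ δ) ∧ p.1.2 = 0},
        ψ ((δ : ℂ) * hexMidpoint s(p.1, p.2)) * conj (hexCenter p.2 - hexCenter p.1) *
          F δ s(p.1, p.2))) / F δ (b δ)‖ ≤ g δ
  obtain ⟨hSC, haB, hbB, hne, -, -, -⟩ := hadmδ
  obtain ⟨hδ0, hδε⟩ := hδ
  -- the root as an explicit boundary edge
  obtain ⟨haE, u, w₀, hauw, hw₀, hu⟩ := haB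
  have huw : hexGraph.Adj u w₀ := by rw [hauw, SimpleGraph.mem_edgeSet] at haE; exact haE
  have haB' : a δ ∈ hexDomainBoundary (Λ δ) := ⟨haE, u, w₀, hauw, hw₀, hu⟩
  -- depth
  set R : ℝ := ε / δ with hRdef
  have hR1 : 1 ≤ R := (one_le_div hδ0).2 hδε.le
  have hδR : δ * R = ε := by rw [hRdef]; field_simp
  -- the black vertices that matter, and their stars
  set B : Finset HexVertex := (Λ δ).filter (fun v => v.2 = 0 ∧ (δ : ℂ) * hexCenter v ∈ K') with hBdef
  have hdeep : ∀ v ∈ B, ∀ y : HexVertex, dist (hexCenter y) (hexCenter v) ≤ R → y ∈ Λ δ := by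
    intro v hv y hy
    refine hexhδ y (hK'K'' (mem_cthickening_of_dist_le _ _ _ _ (Finset.mem_filter.1 hv).2.2 ?_))
    rw [dist_smul_smul hδ0.le, ← hδR]
    exact mul_le_mul_of_nonneg_left hy hδ0.le
  set r : Finset (HexVertex × HexVertex) :=
    (B ×ˢ Λ δ).filter (fun p => hexGraph.Adj p.1 p.2) with hrdef
  have hr : ∀ p : HexVertex × HexVertex,
      p ∈ r ↔ p.1 ∈ B ∧ p.2 ∈ (Λ δ).filter (fun t => hexGraph.Adj p.1 t) := by
    intro p
    simp only [hrdef, Finset.mem_filter, Finset.mem_product]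
    tauto
  -- mid-edges of the relevant stars lie over `K''` (and black endpoints of edges over `K` in `K'`)
  have hmidK : ∀ {x y : HexVertex} {S : Set ℂ}, hexGraph.Adj x y → (δ : ℂ) * hexCenter x ∈ S →
      (δ : ℂ) * hexMidpoint s(x, y) ∈ cthickening ε S := by
    intro x y S hadj hx
    refine mem_cthickening_of_dist_le _ _ _ _ hx ?_
    rw [dist_smul_smul hδ0.le, dist_eq_norm]
    calc δ * ‖hexMidpoint s(x, y) - hexCenter x‖ ≤ δ * (1 / 2) :=
          mul_le_mul_of_nonneg_left (norm_hexMidpoint_sub_hexCenter_le hadj) hδ0.le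
      _ ≤ ε := by linarith
  -- the summand and the regrouping of the finsum
  set f : HexVertex × HexVertex → ℂ := fun p => ψ ((δ : ℂ) * hexMidpoint s(p.1, p.2)) *
    conj (hexCenter p.2 - hexCenter p.1) * F δ s(p.1, p.2) with hfdef
  have hsupp : {p : HexVertex × HexVertex | s(p.1, p.2) ∈ hexDomainMidEdges (Λ δ) ∧ p.1.2 = 0} ∩
      Function.support f = (↑r : Set (HexVertex × HexVertex)) ∩ Function.support f := by
    ext p
    simp only [Set.mem_inter_iff, Set.mem_setOf_eq, Function.mem_support, Finset.mem_coe]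
    constructor
    · rintro ⟨⟨hpE, hp0⟩, hfp⟩
      refine ⟨?_, hfp⟩
      have hadj : hexGraph.Adj p.1 p.2 := (SimpleGraph.mem_edgeSet hexGraph).1 hpE.1
      have hψne : ψ ((δ : ℂ) * hexMidpoint s(p.1, p.2)) ≠ 0 := by
        intro h0; apply hfp
        show ψ ((δ : ℂ) * hexMidpoint s(p.1, p.2)) * conj (hexCenter p.2 - hexCenter p.1) *
          F δ s(p.1, p.2) = 0
        rw [h0, zero_mul, zero_mul]
      have hmK : (δ : ℂ) * hexMidpoint s(p.1, p.2) ∈ K := by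
        by_contra hK; exact hψne (image_eq_zero_of_notMem_tsupport hK)
      have hp1K' : (δ : ℂ) * hexCenter p.1 ∈ K' := by
        refine mem_cthickening_of_dist_le _ _ _ _ hmK ?_
        have h := hmidK hadj (Set.mem_singleton ((δ : ℂ) * hexCenter p.1))
        rw [cthickening_singleton _ hε.le, Metric.mem_closedBall] at h
        rwa [dist_comm]
      have hp1B : p.1 ∈ B := Finset.mem_filter.2 ⟨hexhδ _ (hK'sub hp1K'), hp0, hp1K'⟩
      exact (hr p).2 ⟨hp1B, Finset.mem_filter.2
        ⟨hdeep p.1 hp1B p.2 ((dist_hexCenter_le_one_of_adj hadj).trans hR1), hadj⟩⟩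
    · rintro ⟨hpr, hfp⟩
      obtain ⟨hp1B, hp2⟩ := (hr p).1 hpr
      obtain ⟨hp1Λ, hp0, -⟩ := Finset.mem_filter.1 hp1B
      exact ⟨⟨⟨(SimpleGraph.mem_edgeSet hexGraph).2 (Finset.mem_filter.1 hp2).2, p.1,
        Sym2.mem_mk_left _ _, hp1Λ⟩, hp0⟩, hfp⟩
  have hsum : (∑ᶠ p ∈ {p : HexVertex × HexVertex | s(p.1, p.2) ∈ hexDomainMidEdges (Λ δ) ∧ p.1.2 = 0},
      ψ ((δ : ℂ) * hexMidpoint s(p.1, p.2)) * conj (hexCenter p.2 - hexCenter p.1) * F δ s(p.1, p.2))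
      = ∑ v ∈ B, ∑ t ∈ (Λ δ).filter (fun t => hexGraph.Adj v t), f (v, t) := by
    rw [← Finset.sum_finset_product r B (fun v => (Λ δ).filter (fun t => hexGraph.Adj v t)) hr]
    exact finsum_mem_eq_sum_of_inter_support_eq f hsupp
  -- masses: the stars inject into the mid-edges over `K''`
  set Zf : Sym2 HexVertex → ℝ := fun e =>
    ‖hexParafermionicObservable (Λ δ) (a δ) hexCriticalFugacity 0 e‖ with hZfdef
  set T : ℝ := ∑ v ∈ B, ∑ t ∈ (Λ δ).filter (fun t => hexGraph.Adj v t), Zf s(v, t) with hTdef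
  set E : Set (Sym2 HexVertex) :=
    {e | e ∈ hexDomainMidEdges (Λ δ) ∧ (δ : ℂ) * hexMidpoint e ∈ K''} with hEdef
  have hEfin : E.Finite := (hexDomainMidEdges_finite (Λ δ)).subset fun e he => he.1
  have hTle : T ≤ ∑ᶠ e ∈ E, Zf e := by
    have hinj : Set.InjOn (fun p : HexVertex × HexVertex => s(p.1, p.2)) ↑r := by
      intro p hp q hq hpq
      rcases Sym2.eq_iff.1 hpq with ⟨h1, h2⟩ | ⟨h1, h2⟩
      · exact Prod.ext h1 h2
      · exfalso
        obtain ⟨hq1B, hq2⟩ := (hr q).1 hq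
        have hw := snd_eq_one_of_adj (Finset.mem_filter.1 hq2).2 (Finset.mem_filter.1 hq1B).2.1
        have hb0 : p.1.2 = 0 := (Finset.mem_filter.1 ((hr p).1 hp).1).2.1
        rw [← h1] at hw
        omega
    have himg : r.image (fun p : HexVertex × HexVertex => s(p.1, p.2)) ⊆ hEfin.toFinset := by
      intro e he
      obtain ⟨p, hp, rfl⟩ := Finset.mem_image.1 he
      obtain ⟨hp1B, hp2⟩ := (hr p).1 hp
      have hadj : hexGraph.Adj p.1 p.2 := (Finset.mem_filter.1 hp2).2
      obtain ⟨hp1Λ, -, hp1K'⟩ := Finset.mem_filter.1 hp1B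
      exact (Set.Finite.mem_toFinset _).2 ⟨⟨(SimpleGraph.mem_edgeSet hexGraph).2 hadj, p.1,
        Sym2.mem_mk_left _ _, hp1Λ⟩, hK'K'' (hmidK hadj hp1K')⟩
    calc T = ∑ p ∈ r, Zf s(p.1, p.2) :=
          (Finset.sum_finset_product' r B (fun v => (Λ δ).filter (fun t => hexGraph.Adj v t)) hr
            (f := fun v t => Zf s(v, t))).symm
      _ = ∑ e ∈ r.image (fun p : HexVertex × HexVertex => s(p.1, p.2)), Zf e :=
          (Finset.sum_image hinj).symm
      _ ≤ ∑ e ∈ hEfin.toFinset, Zf e :=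
          Finset.sum_le_sum_of_subset_of_nonneg himg fun _ _ _ => norm_nonneg _
      _ = ∑ᶠ e ∈ E, Zf e := (finsum_mem_eq_finite_toFinset_sum Zf hEfin).symm
  -- the star estimate at every black vertex of `B`, summed
  set A : ℝ := 2 * M₀ * (|C_D| * R ^ (-θ)) + L * δ / 2 with hAdef
  have hRθ0 : 0 ≤ R ^ (-θ) := Real.rpow_nonneg (by linarith) _
  have hA0 : 0 ≤ A := by positivity
  have hstar : ∀ v ∈ B, ‖∑ t ∈ (Λ δ).filter (fun t => hexGraph.Adj v t), f (v, t)‖ ≤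
      A * ∑ t ∈ (Λ δ).filter (fun t => hexGraph.Adj v t), Zf s(v, t) := by
    intro v hv
    have hdef := hDD (Λ δ) hSC u w₀ huw hu hw₀ v R hR1 (hdeep v hv)
    rw [← hauw] at hdef
    refine star_sum_norm_le hM₀ hL hL0 hδ0.le v (hdef.trans ?_)
    exact mul_le_mul_of_nonneg_right (mul_le_mul_of_nonneg_right (le_abs_self _) hRθ0)
      (Finset.sum_nonneg fun _ _ => norm_nonneg _)
  have hS : ‖∑ v ∈ B, ∑ t ∈ (Λ δ).filter (fun t => hexGraph.Adj v t), f (v, t)‖ ≤ A * T := by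
    rw [hTdef, Finset.mul_sum]
    exact (norm_sum_le _ _).trans (Finset.sum_le_sum hstar)
  -- normalisation at `b δ` and MassRatio with a nonnegative constant
  have hFb : ‖F δ (b δ)‖ = Zf (b δ) := norm_obs_eq_of_rigidity hW hSC haB' hbB _ _
  have hZb : 0 < Zf (b δ) := norm_obs_zero_pos hne hxc
  have hCM' : δ ^ 2 * (∑ᶠ e ∈ E, Zf e) ≤ |C_M| * δ ^ (-(3 : ℝ) / 4) * Zf (b δ) :=
    hCMδ.trans (mul_le_mul_of_nonneg_right
      (mul_le_mul_of_nonneg_right (le_abs_self _) (Real.rpow_nonneg hδ0.le _)) (norm_nonneg _))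
  -- assemble
  rw [hsum, norm_div, norm_mul, norm_pow, Complex.norm_of_nonneg hδ0.le, hFb, div_le_iff₀ hZb]
  have hRθ : R ^ (-θ) = ε ^ (-θ) * δ ^ θ := by
    rw [hRdef, Real.div_rpow hε.le hδ0.le, Real.rpow_neg hδ0.le θ, div_inv_eq_mul]
  have h1 : δ ^ θ * δ ^ (-(3 : ℝ) / 4) = δ ^ (θ - 3 / 4) := by
    rw [← Real.rpow_add hδ0]; congr 1; ring
  have h2 : δ * δ ^ (-(3 : ℝ) / 4) = δ ^ (1 / 4 : ℝ) := by
    rw [show (1 / 4 : ℝ) = 1 + -(3 : ℝ) / 4 by norm_num, Real.rpow_add hδ0, Real.rpow_one]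
  calc δ ^ 2 * ‖∑ v ∈ B, ∑ t ∈ (Λ δ).filter (fun t => hexGraph.Adj v t), f (v, t)‖
      ≤ δ ^ 2 * (A * T) := mul_le_mul_of_nonneg_left hS (by positivity)
    _ = A * (δ ^ 2 * T) := by ring
    _ ≤ A * (δ ^ 2 * ∑ᶠ e ∈ E, Zf e) :=
        mul_le_mul_of_nonneg_left (mul_le_mul_of_nonneg_left hTle (by positivity)) hA0
    _ ≤ A * (|C_M| * δ ^ (-(3 : ℝ) / 4) * Zf (b δ)) := mul_le_mul_of_nonneg_left hCM' hA0
    _ = (2 * M₀ * |C_D| * |C_M| * ε ^ (-θ) * (δ ^ θ * δ ^ (-(3 : ℝ) / 4)) +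
          L / 2 * |C_M| * (δ * δ ^ (-(3 : ℝ) / 4))) * Zf (b δ) := by rw [hAdef, hRθ]; ring
    _ = g δ * Zf (b δ) := by rw [h1, h2]

end

end Summit.CriticalPhenomena.SAWScalingLimit.Theorems
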